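import Literature.AlgebraicGeometry.ModuliOfAbelianVarieties.SiegelFamilyPrincipalLevelFreeAction
import HarnessLib

/-!
# The real locus `ℍ_g^{τΓ} = ⋃_{γ ∈ Γ} ℍ_g^{τγ}` of the Siegel modular variety is CLOSED in `𝔥_g`: the
# family of real slices `ℍ_g^{τγ} = {Ω : γ • Ω = −Ω̄}`, `γ ∈ Γ_g`, is locally finite (Lange, Prop. 3.1.9),
# each slice is closed, and at level `q ≥ 3` the slices are pairwise disjoint
# (Goresky–Tai 2003, §4.2, Thm. 8, Prop. 6; Yang 2015, §2 (2.5)–(2.6); Lange 2023, Prop. 3.1.9)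

Topic `Literature/AlgebraicGeometry/ModuliOfAbelianVarieties` (the Siegel-family files, namespace
`Literature.AlgebraicGeometry.ModuliOfAbelianVarieties.SiegelModuli`).  Lane `lit-hodgefound` (Track 2
foundations library), prover seat p15 generation 51, row g51-#7 (successor menu (b) of gen 50), on top of
g51-#6 `SiegelFamilyPrincipalLevelFreeAction` (at level `q ≥ 3` two distinct `γ`'s have disjoint real
slices), g50-#7 `SiegelFamilyRealModuliPoints` (`τΩ = −Ω̄`, `ℍ_g^{τx}`) and the tree's
`SiegelUpperHalfSpaceProperAction` (Lange Prop. 3.1.9: for compact `K₁, K₂ ⊂ 𝔥_g` only finitely many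
`M ∈ Γ` have `M(K₁) ∩ K₂ ≠ ∅`; `𝔥_g` locally compact; the action is continuous).  THEOREMS ONLY: no
definition, no instance, no notation, no named fact (net Literature debt `0`), no `sorry`.

## Sources, VERBATIM

* M. Goresky, Y. S. Tai, Compositio Math. **139** (2003) = arXiv:math/0108103, held `paper:arxiv-math_0108103`,
  §4.2 p0007: «The involution `τ(Z) = −Z̄` passes to an anti-holomorphic involution on `X` and defines a real
  structure (let us call it the `τ`-real structure) on `X`. … Define `S = ⋃_{γ ∈ Γ(4m)} 𝔥_n^γ ⊂ 𝔥_n` to be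
  the set of all `Γ(4m)`-real points in `𝔥_n`. … the image `[Z] ∈ X` of a point `Z ∈ 𝔥_n` lies in `X_ℝ` iff
  there exists `γ ∈ Γ(4m)` such that `γZ = −Z̄` (i.e. such that `Z ∈ 𝔥_n^γ`)»; «**Theorem 8.** The set
  `X_ℝ` of real points of `X` is precisely `Γ(4m)∖S`.  It consists of the disjoint union
  `X_ℝ = ∐_g {}^gΓ_ℓ(4m)∖giC_n` of finitely many copies of `Γ_ℓ(4m)∖C_n`»; §3 p0006 Prop. 6: «if
  `γ₁, γ₂ ∈ Γ` are distinct then `𝔥_n^{γ₁} ∩ 𝔥_n^{γ₂} = ∅`».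
* J.-H. Yang, *Polarized real tori*, J. Korean Math. Soc. **52** (2015) = arXiv:0912.5084, held
  `paper:arxiv-0912.5084`, §2 p0004–p0005: «For `x ∈ Sp(g, ℝ)` and `Ω ∈ ℍ_g`, we define the set
  `ℍ_g^{τx} := {Ω ∈ ℍ_g | x·Ω = τ(Ω) = −Ω̄}` … be the locus of `x`-real points.  If `Γ ⊂ Sp(g, ℝ)` is an
  arithmetic subgroup of `Sp(g, ℝ)` such that `τ(Γ) = Γ`, we define `ℍ_g^{τΓ} := ⋃_{γ ∈ Γ} ℍ_g^{τγ}`.»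
* H. Lange, *Abelian Varieties over the Complex Numbers* (2023), §3.1.3 Prop. 3.1.9 (held p0161): «Any
  discrete subgroup `G ⊂ Sp_{2g}(ℝ)` acts properly and discontinuously on `𝔥_g`», i.e. «for any pair of
  compact subsets `K₁, K₂` of `𝔥_g` the set `{g ∈ G | gK₁ ∩ K₂ ≠ ∅}` is finite».

## What is proved (`Γ_g = siegelModularGroup g`, `Γ_g(q) = ι(siegelPrincipalGamma g q)`, `τΩ = −Ω̄`)

* §1 `continuous_negConj` (`τ : 𝔥_g → 𝔥_g` is continuous), **`isClosed_setOf_smul_eq_negConj`** (every real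
  slice `ℍ_g^{τx}`, `x ∈ Sp_{2g}(ℝ)`, is closed in `𝔥_g`).
* §2 **`locallyFinite_setOf_smul_eq_negConj`** (the family `(ℍ_g^{τγ})_{γ ∈ Γ_g}` is locally finite: a
  compact neighbourhood `K` of a point meets `ℍ_g^{τγ}` only if `γ(K) ∩ τ(K) ≠ ∅`, finitely many `γ` by
  Prop. 3.1.9), `finite_setOf_inter_nonempty_of_isCompact` (a compact set meets finitely many slices),
  `locallyFinite_setOf_symplecticIntHom_smul_eq_negConj` (the same along `Γ_g(q)`).
* §3 **`isClosed_setOf_exists_smul_eq_negConj`** — THE REAL LOCUS `ℍ_g^{τΓ_g} = ⋃_{γ ∈ Γ_g} ℍ_g^{τγ}` IS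
  CLOSED in `𝔥_g` (the preimage of `X_ℝ`, «`[Z] ∈ X_ℝ` iff there exists `γ` such that `γZ = −Z̄`»), and
  **`isClosed_setOf_exists_mem_siegelPrincipalGamma_smul_eq_negConj`** (the set `S` of `Γ(q)`-real points is
  closed, every `q`).
* §4 **`pairwise_disjoint_setOf_symplecticIntHom_smul_eq_negConj`** (`q ≥ 3`: the slices `ℍ_g^{τγ}`,
  `γ ∈ Γ_g(q)`, are pairwise DISJOINT — «`𝔥_n^{γ₁} ∩ 𝔥_n^{γ₂} = ∅`», the disjointness in Theorem 8's
  `X_ℝ = ∐_g …`), so `S` is a locally finite disjoint union of closed real slices.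

## References

* [GoreskyTai2003RealModuli] M. Goresky, Y. S. Tai, Compositio Math. 139 (2003) 1–27, §3 Prop. 6, §4.2, Thm. 8.
* [Yang2015PolarizedRealTori] J.-H. Yang, J. Korean Math. Soc. 52 (2015), §2 (2.5)–(2.6), Lemma 2.
* [Lange2023AbelianVarietiesComplex] H. Lange (2023), §3.1.3 Prop. 3.1.8–3.1.9, §3.1.4 Thm. 3.1.11.
* [Silhol1989] R. Silhol, *Real Algebraic Surfaces*, LNM 1392 (1989), Ch. IV §4 («the real part of the
  complex moduli space»).
-/

noncomputable section

open scoped Manifold Matrix ComplexConjugate Topology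
open Matrix Function

namespace Literature.AlgebraicGeometry.ModuliOfAbelianVarieties

namespace SiegelModuli

open Literature.NumberTheory.Automorphic (siegelUpperHalfSpace)
open Literature.NumberTheory.ModularForms.SiegelUpperHalfSpace (symplecticIntHom siegelModularGroup
  symplecticIntHom_injective finite_setOf_image_smul_inter_nonempty)
open Literature.NumberTheory.ModularForms.SiegelModularForm (siegelPrincipalGamma)

variable {g : ℕ}

/-! ## §1 `τ` is continuous; every real slice `ℍ_g^{τx}` is closed -/

/-- **`τ : 𝔥_g → 𝔥_g`, `Ω ↦ −Ω̄`, is continuous** (an anti-holomorphic involution of `𝔥_g`).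
[cite: GoreskyTai2003RealModuli, §2.3 and §4.2 («The involution `τ(Z) = −Z̄` passes to an anti-holomorphic involution on `X`»)] [cite: Yang2015PolarizedRealTori, §2 (2.4)] -/
theorem continuous_negConj :
    Continuous fun Ω : siegelUpperHalfSpace g ↦
      (⟨-(Ω : Matrix (Fin g) (Fin g) ℂ).map conj, neg_map_conj_mem_siegelUpperHalfSpace Ω.2⟩ : siegelUpperHalfSpace g) :=
  Continuous.subtype_mk ((continuous_subtype_val.matrix_map Complex.continuous_conj).neg) _

/-- **Every real slice `ℍ_g^{τx} = {Ω ∈ 𝔥_g : x • Ω = −Ω̄}` is closed** (`x ∈ Sp_{2g}(ℝ)`): the equaliser of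
the continuous maps `Ω ↦ x • Ω` and `τ`. [cite: Yang2015PolarizedRealTori, §2 (2.5) («`ℍ_g^{τx} := {Ω ∈ ℍ_g | x·Ω = τ(Ω) = −Ω̄}`»)] [cite: GoreskyTai2003RealModuli, §4.2] -/
theorem isClosed_setOf_smul_eq_negConj (x : Matrix.symplecticGroup (Fin g) ℝ) :
    IsClosed {Ω : siegelUpperHalfSpace g |
      x • Ω = ⟨-(Ω : Matrix (Fin g) (Fin g) ℂ).map conj, neg_map_conj_mem_siegelUpperHalfSpace Ω.2⟩} :=
  isClosed_eq (continuous_const_smul x) continuous_negConj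

/-! ## §2 The family of real slices along `Γ_g` is locally finite -/

/-- **`(ℍ_g^{τγ})_{γ ∈ Γ_g}` is a locally finite family**: a compact neighbourhood `K` of `Ω₀` meets
`ℍ_g^{τγ}` only if `γ(K) ∩ τ(K) ≠ ∅`, which happens for finitely many `γ ∈ Γ_g` («for any pair of compact
subsets `K₁, K₂` of `𝔥_g` the set `{g ∈ G | gK₁ ∩ K₂ ≠ ∅}` is finite», with `K₁ = K`, `K₂ = τ(K)`).
[cite: Lange2023AbelianVarietiesComplex, §3.1.3 Prop. 3.1.9, pp. 161–162] [cite: GoreskyTai2003RealModuli, §4.2 («`S = ⋃_{γ ∈ Γ(4m)} 𝔥_n^γ`»)] -/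
theorem locallyFinite_setOf_smul_eq_negConj :
    LocallyFinite fun γ : siegelModularGroup g ↦ {Ω : siegelUpperHalfSpace g |
      (γ : Matrix.symplecticGroup (Fin g) ℝ) • Ω =
        ⟨-(Ω : Matrix (Fin g) (Fin g) ℂ).map conj, neg_map_conj_mem_siegelUpperHalfSpace Ω.2⟩} := by
  intro Ω₀
  obtain ⟨K, hK, hKΩ₀⟩ := exists_compact_mem_nhds Ω₀
  refine ⟨K, hKΩ₀, ?_⟩
  refine (finite_setOf_image_smul_inter_nonempty (siegelModularGroup g) hK (hK.image continuous_negConj)).subset ?_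
  rintro γ ⟨Ω, hΩγ, hΩK⟩
  exact ⟨(γ : Matrix.symplecticGroup (Fin g) ℝ) • Ω, ⟨Ω, hΩK, rfl⟩, ⟨Ω, hΩK, hΩγ.symm⟩⟩

/-- **A compact subset of `𝔥_g` meets only finitely many real slices `ℍ_g^{τγ}`, `γ ∈ Γ_g`.**
[cite: Lange2023AbelianVarietiesComplex, §3.1.3 Prop. 3.1.9] [cite: GoreskyTai2003RealModuli, §4.2] -/
theorem finite_setOf_inter_nonempty_of_isCompact {K : Set (siegelUpperHalfSpace g)} (hK : IsCompact K) :
    {γ : siegelModularGroup g | ({Ω : siegelUpperHalfSpace g |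
      (γ : Matrix.symplecticGroup (Fin g) ℝ) • Ω =
        ⟨-(Ω : Matrix (Fin g) (Fin g) ℂ).map conj, neg_map_conj_mem_siegelUpperHalfSpace Ω.2⟩} ∩ K).Nonempty}.Finite :=
  locallyFinite_setOf_smul_eq_negConj.finite_nonempty_inter_compact hK

/-- The same family along a principal congruence subgroup `Γ_g(q)` (a subfamily) is locally finite.
[cite: Lange2023AbelianVarietiesComplex, §3.1.3 Prop. 3.1.9 and §3.2 (the groups `Γ_D(n)`)] [cite: GoreskyTai2003RealModuli, §4.2] -/
theorem locallyFinite_setOf_symplecticIntHom_smul_eq_negConj (q : ℕ) :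
    LocallyFinite fun γ : siegelPrincipalGamma g q ↦ {Ω : siegelUpperHalfSpace g |
      symplecticIntHom g (γ : Matrix.symplecticGroup (Fin g) ℤ) • Ω =
        ⟨-(Ω : Matrix (Fin g) (Fin g) ℂ).map conj, neg_map_conj_mem_siegelUpperHalfSpace Ω.2⟩} := by
  have h := locallyFinite_setOf_smul_eq_negConj (g := g) |>.comp_injective
    (g := fun γ : siegelPrincipalGamma g q ↦
      (⟨symplecticIntHom g (γ : Matrix.symplecticGroup (Fin g) ℤ), ⟨γ, rfl⟩⟩ : siegelModularGroup g))
    (fun γ₁ γ₂ hγ ↦ Subtype.ext (symplecticIntHom_injective (congrArg Subtype.val hγ)))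
  exact h

/-! ## §3 The real locus `ℍ_g^{τΓ}` is closed -/

/-- **THE REAL LOCUS `ℍ_g^{τΓ_g} = ⋃_{γ ∈ Γ_g} ℍ_g^{τγ}` IS CLOSED IN `𝔥_g`** — the set of period points lying
over the real points of `𝔄_g = Γ_g∖𝔥_g` («`[Z] ∈ X_ℝ` iff there exists `γ` such that `γZ = −Z̄`»): a locally
finite union (§2) of closed sets (§1). [cite: GoreskyTai2003RealModuli, §4.2 (the set `S`) and Thm. 8 («`X_ℝ` … is precisely `Γ(4m)∖S`»)] [cite: Yang2015PolarizedRealTori, §2 (2.6) («`ℍ_g^{τΓ} := ⋃_{γ ∈ Γ} ℍ_g^{τγ}`»)] [cite: Lange2023AbelianVarietiesComplex, §3.1.3 Prop. 3.1.9] -/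
theorem isClosed_setOf_exists_smul_eq_negConj :
    IsClosed {Ω : siegelUpperHalfSpace g | ∃ γ ∈ siegelModularGroup g,
      γ • Ω = ⟨-(Ω : Matrix (Fin g) (Fin g) ℂ).map conj, neg_map_conj_mem_siegelUpperHalfSpace Ω.2⟩} := by
  have h : {Ω : siegelUpperHalfSpace g | ∃ γ ∈ siegelModularGroup g,
      γ • Ω = ⟨-(Ω : Matrix (Fin g) (Fin g) ℂ).map conj, neg_map_conj_mem_siegelUpperHalfSpace Ω.2⟩} =
      ⋃ γ : siegelModularGroup g, {Ω : siegelUpperHalfSpace g |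
        (γ : Matrix.symplecticGroup (Fin g) ℝ) • Ω =
          ⟨-(Ω : Matrix (Fin g) (Fin g) ℂ).map conj, neg_map_conj_mem_siegelUpperHalfSpace Ω.2⟩} := by
    ext Ω
    simp only [Set.mem_setOf_eq, Set.mem_iUnion]
    exact ⟨fun ⟨γ, hγ, hΩ⟩ ↦ ⟨⟨γ, hγ⟩, hΩ⟩, fun ⟨γ, hΩ⟩ ↦ ⟨γ, γ.2, hΩ⟩⟩
  rw [h]
  exact locallyFinite_setOf_smul_eq_negConj.isClosed_iUnion fun γ ↦ isClosed_setOf_smul_eq_negConj _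

/-- **The set `S = ⋃_{γ ∈ Γ(q)} 𝔥_g^γ` of `Γ_g(q)`-real points is closed in `𝔥_g`** (every level `q`; the
preimage of the real points `X_ℝ = Γ(q)∖S` of `X = Γ_g(q)∖𝔥_g`). [cite: GoreskyTai2003RealModuli, §4.2 («Define `S = ⋃_{γ ∈ Γ(4m)} 𝔥_n^γ` … the set of all `Γ(4m)`-real points») and Thm. 8] [cite: Lange2023AbelianVarietiesComplex, §3.1.3 Prop. 3.1.9] -/
theorem isClosed_setOf_exists_mem_siegelPrincipalGamma_smul_eq_negConj (q : ℕ) :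
    IsClosed {Ω : siegelUpperHalfSpace g | ∃ γ ∈ siegelPrincipalGamma g q,
      symplecticIntHom g γ • Ω = ⟨-(Ω : Matrix (Fin g) (Fin g) ℂ).map conj, neg_map_conj_mem_siegelUpperHalfSpace Ω.2⟩} := by
  have h : {Ω : siegelUpperHalfSpace g | ∃ γ ∈ siegelPrincipalGamma g q,
      symplecticIntHom g γ • Ω = ⟨-(Ω : Matrix (Fin g) (Fin g) ℂ).map conj, neg_map_conj_mem_siegelUpperHalfSpace Ω.2⟩} =
      ⋃ γ : siegelPrincipalGamma g q, {Ω : siegelUpperHalfSpace g |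
        symplecticIntHom g (γ : Matrix.symplecticGroup (Fin g) ℤ) • Ω =
          ⟨-(Ω : Matrix (Fin g) (Fin g) ℂ).map conj, neg_map_conj_mem_siegelUpperHalfSpace Ω.2⟩} := by
    ext Ω
    simp only [Set.mem_setOf_eq, Set.mem_iUnion]
    exact ⟨fun ⟨γ, hγ, hΩ⟩ ↦ ⟨⟨γ, hγ⟩, hΩ⟩, fun ⟨γ, hΩ⟩ ↦ ⟨γ, γ.2, hΩ⟩⟩
  rw [h]
  exact (locallyFinite_setOf_symplecticIntHom_smul_eq_negConj q).isClosed_iUnion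
    fun γ ↦ isClosed_setOf_smul_eq_negConj _

/-! ## §4 At level `q ≥ 3` the real slices are pairwise disjoint -/

/-- **`q ≥ 3`: the real slices `ℍ_g^{τγ}`, `γ ∈ Γ_g(q)`, are pairwise disjoint** («if `γ₁, γ₂ ∈ Γ` are
distinct then `𝔥_n^{γ₁} ∩ 𝔥_n^{γ₂} = ∅`»; g51-#6: `Γ_g(q)` acts freely), so `S` is a locally finite DISJOINT
union of closed slices — the disjointness in «`X_ℝ = ∐_g {}^gΓ_ℓ(4m)∖giC_n`».
[cite: GoreskyTai2003RealModuli, §3 Prop. 6 (last clause) and §4 Thm. 8] -/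
theorem pairwise_disjoint_setOf_symplecticIntHom_smul_eq_negConj {q : ℕ} (hq : 3 ≤ q) :
    Pairwise (Disjoint on fun γ : siegelPrincipalGamma g q ↦ {Ω : siegelUpperHalfSpace g |
      symplecticIntHom g (γ : Matrix.symplecticGroup (Fin g) ℤ) • Ω =
        ⟨-(Ω : Matrix (Fin g) (Fin g) ℂ).map conj, neg_map_conj_mem_siegelUpperHalfSpace Ω.2⟩}) :=
  fun γ₁ γ₂ hne ↦ Set.disjoint_left.2 fun _ h₁ h₂ ↦
    hne (Subtype.ext (eq_of_smul_eq_negConj_of_mem_siegelPrincipalGamma hq γ₁.2 γ₂.2 h₁ h₂))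

/-- **Each point of `S` lies on exactly one slice** (`q ≥ 3`): if `Ω` is `Γ_g(q)`-real then there is a UNIQUE
`γ ∈ Γ_g(q)` with `γ • Ω = −Ω̄`. [cite: GoreskyTai2003RealModuli, §3 Prop. 6 and §4 Thm. 8 (the indexing of `X_ℝ` by `H¹(ℂ/ℝ, Γ(4m))`)] -/
theorem existsUnique_mem_siegelPrincipalGamma_smul_eq_negConj {q : ℕ} (hq : 3 ≤ q) {Ω : siegelUpperHalfSpace g}
    (hΩ : ∃ γ ∈ siegelPrincipalGamma g q,
      symplecticIntHom g γ • Ω = ⟨-(Ω : Matrix (Fin g) (Fin g) ℂ).map conj, neg_map_conj_mem_siegelUpperHalfSpace Ω.2⟩) :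
    ∃! γ : Matrix.symplecticGroup (Fin g) ℤ, γ ∈ siegelPrincipalGamma g q ∧
      symplecticIntHom g γ • Ω = ⟨-(Ω : Matrix (Fin g) (Fin g) ℂ).map conj, neg_map_conj_mem_siegelUpperHalfSpace Ω.2⟩ := by
  obtain ⟨γ, hγ, h⟩ := hΩ
  exact ⟨γ, ⟨hγ, h⟩, fun γ' ⟨hγ', h'⟩ ↦ eq_of_smul_eq_negConj_of_mem_siegelPrincipalGamma hq hγ' hγ h' h⟩

end SiegelModuli

end Literature.AlgebraicGeometry.ModuliOfAbelianVarieties
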